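import Literature.MathematicalPhysics.QuantumFieldTheory.Balaban1983to89.T4ContinuumCoupling

/-!
# `Balaban1983to89.T4BetaStationary` — node U2 / NE4 (P1 side): THE CONTINUUM β-FUNCTIONAL.  Node U2's typed
NE4 shapes (`T4CouplingMatching.ScaleShiftRate`, `HistLipschitz`, `FadingMemory`) say exactly that the
history-dependent lattice β-functions `β_k(g_0,…,g_k)`, read from the infrared end, are a GEOMETRICALLY FAST
STATIONARY APPROXIMATION of ONE scale-independent functional `betaInf β` on semi-infinite coupling histories, with
GEOMETRIC FADING MEMORY; conversely every such functional generates a family with the NE4 shapes; and the functional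
IS the β of P2's continuum flow: `1/(g⋆_{m+1})² = 1/(g⋆_m)² + betaInf β (g⋆_{m+1}, g⋆_{m+2}, …)` (kernel; elementary
real analysis, [folklore]; cell `pub-balaban`, T4-DAG v21 §2 node U2 / §6 NE4; journal row T4-U2.NE4-PROVE-P1i*;
NO estimate of the cell's NEW-ESTIMATE kind).

HONEST FRAMING (T4-DAG PAGE 1).  The cell's T4 target is the existence AND uniqueness of the continuum limit of
Bałaban's unit-scale expectations on a FIXED FINITE torus T⁴ (rung (B)+1): NOT infinite volume, NOT the Yang–Mills
mass gap, NOT the Clay problem.  This module is NOT summit progress and proves NO estimate about Bałaban's objects: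
every theorem below takes node U2's NE4 shapes as DISPLAYED HYPOTHESES (`ScaleShiftRate c θ γ β`,
`HistLipschitz Λ γ β`, `FadingMemory Cm θ Λ`) — they are NOT PRINTED in any form (register `t4/CITED-FACTS-T4.md`
§2 NE4; GAPS G-t4-U2-1 «NO statement on the k-dependence of β_{k+1} — no convergence β_{k+1} → β_∞, no rate»;
G-t4-U2-2; record `t4/T4-EST-NE4-P1.md` §8) and stay so; where P2's continuum couplings enter (§5), node U2's OUTPUT
shape `InjectedRate C 0 θ (disc …)` and the runs `RGEqH K β (g K)` in the box are displayed hypotheses exactly as in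
`T4ContinuumCoupling`.  `BetaPertH` / (B) / (B^μ) do not occur in this module.

MOTIVATION (the one printed sentence; read first-hand by this unit on the cell's render
`b2b-balaban-ref1/pages/1987-cmp109-rg-I-small-field/1987-cmp109-rg-I-small-field-p007-x2.png`, journal page = PDF
page + 248).  [Balaban1987RG1] = T. Bałaban, *Renormalization group approach to lattice gauge field theories. I*,
Commun. Math. Phys. **109**, 249–301 (1987), p. 255, after (0.18): «The equation (0.18) written in the form
(1/g₁²) − (1/g₀²) = (d(1/g²))₀ = −β₁(g₀) is a finite difference approximation, corresponding to two consecutive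
lattice spacings (on a logarithmic scale) of the differential equation (d/ds)(1/g²) = −β(g), or (dg/ds) = 1/2β(g)g³.
This is the usual differential renormalization group equation, an example of a Callan-Symanzik equation, considered
in quantum field theory.»  The heuristic names ONE function β of the coupling; the lattice objects are a SEQUENCE
β_1, β_2, … (same page: «This is a function in a sequence of β-functions.»), each depending on the whole preceding
history (p. 298, the sentence carried verbatim by `FlowStep`'s certified header).  Print proves nothing that turns the
sequence into one function (G-t4-U2-1).  WHAT THIS MODULE SHOWS, in the kernel, is that node U2's typed hypotheses
are PRECISELY such a statement, and what the resulting continuum object is: a functional of the semi-infinite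
coupling history with geometric memory — not a function of one coupling, unless the memory constant vanishes.

CONTENT (all [folklore]; kernel-checked, no `sorry`, standard axioms).  Orientation: the tree's prefixes
`v : Fin (k+1) → ℝ` have index 0 = FINEST coupling, index k = the LAST (coarsest) one (`FlowStep.HBeta`,
`ScaleShiftRate` drops the finest entry by `Fin.tail`).  A REVERSED HISTORY is `h : ℕ → ℝ` with `h 0` = the last
coupling, `h j` = the coupling j scales finer ("age j").
 §1 `SeqBox γ h` (every `h j ∈ ]0,γ]`), `revHist h k = (h k, …, h 0)` as a tree prefix, `tail_revHist`
    (`Fin.tail (revHist h (k+1)) = revHist h k` — THE identity behind everything), `padHist p v` (a prefix padded to a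
    reversed history by a value p), `revHist_padHist` (`revHist (padHist p v) k = v`), `sum_fin_eq_sum_range_age`.
 §2 `ScaleShiftRate c θ γ β`, `θ < 1` ⇒ for every box-valued reversed history the values `β k (revHist h k)` converge
    (`tendsto_betaInf`) to `betaInf β h := limUnder …` with the tail `|β k (revHist h k) − betaInf β h| ≤ cθ^k/(1−θ)`
    (`abs_beta_revHist_sub_betaInf_le`, by name `T4EtaRateMin.exists_limit_of_geomRate`); REPRESENTATION
    `abs_beta_sub_betaInf_padHist_le`: `|β k v − betaInf β (padHist p v)| ≤ cθ^k/(1−θ)` on the box — the lattice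
    β-functions ARE the one functional up to a geometric error, uniformly in the history.
 §3 `HistLipschitz Λ γ β ∧ FadingMemory Cm θ Λ` ⇒ level-k profile `abs_beta_revHist_sub_le_sum`
    (`≤ Σ_{j≤k} Cm θ^j |h j − h′ j|`), and in the limit `memoryProfile_betaInf`:
    `|betaInf β h − betaInf β h′| ≤ Cm · Σ'_j θ^j |h j − h′ j|` (`MemoryProfile Cm θ γ (betaInf β)`); depth form
    `abs_betaInf_sub_le_of_agree` (histories agreeing below age N differ by `≤ Cm·γθ^N/(1−θ)` — in particular the
    padding value is immaterial, `abs_betaInf_padHist_sub_padHist_le`); bounds pass to the limit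
    (`le_betaInf_of_betaLower`, `betaInf_le_of_betaUpper`, `le_betaInf_of_eventualLower`).
 §4 CONVERSE (stationary families): `ofFunctional B p k v := B (padHist p v)`; `MemoryProfile Cm θ γ B` ⇒
    `scaleShiftRate_ofFunctional` (`ScaleShiftRate (Cm·γ·θ) θ γ`), `histLipschitz_ofFunctional` (moduli
    `Λ k i = Cm θ^(k−i)`), `fadingMemory_geom`; families NEAR a functional (`|β k v − B (padHist p v)| ≤ c′θ^k`) have
    `ScaleShiftRate (Cm·γ·θ + 2c′) θ γ` (`scaleShiftRate_of_near_ofFunctional`); ROUND TRIP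
    `scaleShiftRate_roundTrip`: NE4's shapes ⇒ (functional, profile, representation) ⇒ NE4's shift rate back with
    constant `Cm·γ·θ + 2c/(1−θ)` — the hypothesis CLASS is stable, only constants move.
 §5 IDENTIFICATION WITH P2's CONTINUUM COUPLINGS (`T4ContinuumCoupling`, unit t4-ne4-p2, BY NAME: `gstar`, `bstar`,
    `tendsto_coupling`, `tendsto_beta_diag`, `gstar_flow`): along the runs, the reversed history above physical
    scale m (`histAbove g m n`) converges agewise to `limHist g m j = gstar g (m+1+j)` (`tendsto_histAbove`); by
    Tannery's theorem (Mathlib `tendsto_tsum_of_dominated_convergence`) and the memory profile,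
    `tendsto_betaInf_histAbove`; hence `tendsto_beta_diag_betaInf`, **`bstar_eq_betaInf`**
    (`bstar g m = betaInf β (limHist g m)`) and **`gstar_flow_autonomous`**:
    `1/(gstar g (m+1))² = 1/(gstar g m)² + betaInf β (fun j => gstar g (m+1+j))` — (0.20) in the continuum with ONE
    scale-independent β-functional evaluated on the limit trajectory's own ultraviolet history (an implicit,
    non-Markovian consistency condition read upward from `gstar g 0 = g_IR`; its unique solvability is the limit form
    of P2's two-run uniqueness and is NOT treated here).
 §6 DEPENDENCY LEMMA `betaContH_of_histLipschitz`: `HistLipschitz Λ γ β → FlowStep.BetaContH γ β` — the headline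
    binder (C) of `T4ContinuumYM4Torus.continuumYM4_torus_of_BetaPertH` is implied, on the same box, by node U2's
    Lipschitz input (GAPS G-t4-U2-2 records only that the converse fails).
 §7 `Probes` (non-vacuity with GENUINE memory, kernel): the exponentially weighted history average
    `expAvg a θ h = a·Σ'_j θ^j h j` has `MemoryProfile |a| θ γ`, so `ofFunctional (expAvg a θ) p` — a family depending
    on EVERY past coupling — satisfies node U2's full NE4 triple BY NAME (§4); and a stationary Markov family is the
    memoryless case.

CITATION HEADER (lean-in-tree rule 2026-08-18).  The two «…» spans above ([Balaban1987RG1] p. 255) are the ONLY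
passages quoted in this module; they were read first-hand by this unit on the named render; they are MOTIVATION and
are NOT used as hypotheses — every theorem below is elementary real analysis proved here over the tree's typed
shapes.  ABSOLUTE RULE: no internally-minted statement and no step of the manuscripts under audit enters as a cited
fact.  The Bałaban papers are manuscripts UNDER ADJUDICATION by the audit cell `pub-balaban`: NOTHING printed in them
is asserted here.  NEW module of unit `b2b-balaban-t4-ne4-p1-g11` (NE4 prover P1, gen 11; journal CLAIM
T4-U2.NE4-PROVE-P1i* l.54482); imports the tree module `T4ContinuumCoupling` (unit t4-ne4-p2) and through it
`T4CouplingMatching` (pv16), `T4EtaRateMin`, `T4CauchySum`, `FlowStep` BY NAME, and modifies nothing.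
-/

namespace Literature.MathematicalPhysics.QuantumFieldTheory.Balaban1983to89.T4BetaStationary

open Literature.MathematicalPhysics.QuantumFieldTheory.Balaban1983to89
open Literature.MathematicalPhysics.QuantumFieldTheory.Balaban1983to89.FlowStep
open Literature.MathematicalPhysics.QuantumFieldTheory.Balaban1983to89.T4CouplingMatching
open Literature.MathematicalPhysics.QuantumFieldTheory.Balaban1983to89.T4CauchySum (GeomRate InjectedRate)
open Literature.MathematicalPhysics.QuantumFieldTheory.Balaban1983to89.T4EtaRateMin (exists_limit_of_geomRate)
open Literature.MathematicalPhysics.QuantumFieldTheory.Balaban1983to89.T4ContinuumCoupling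
  (gstar bstar tendsto_coupling tendsto_beta_diag gstar_flow gstar_pos gstar_le)
open Filter Topology Finset

noncomputable section

/-! ## §1 Reversed histories, padding, and the age reindexing -/

/-- A box-valued SEMI-INFINITE REVERSED COUPLING HISTORY: `h 0` = the last (coarsest) coupling, `h j` = the coupling
`j` scales finer; every entry in `]0,γ]`. [folklore] -/
def SeqBox (γ : ℝ) (h : ℕ → ℝ) : Prop := ∀ j, 0 < h j ∧ h j ≤ γ

/-- The level-`k` prefix read off a reversed history, in the tree's orientation (index 0 = finest):
`revHist h k = (h k, h (k−1), …, h 0)`. [folklore] -/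
def revHist (h : ℕ → ℝ) (k : ℕ) : Fin (k + 1) → ℝ := fun i => h (k - i)

/-- Unfolding of `revHist`. [folklore] -/
@[simp] theorem revHist_apply (h : ℕ → ℝ) (k : ℕ) (i : Fin (k + 1)) : revHist h k i = h (k - i) := rfl

/-- The last (coarsest) entry of `revHist h k` is `h 0`. [folklore] -/
theorem revHist_last (h : ℕ → ℝ) (k : ℕ) : revHist h k (Fin.last k) = h 0 := by simp

/-- The finest entry of `revHist h k` is `h k`. [folklore] -/
theorem revHist_zero (h : ℕ → ℝ) (k : ℕ) : revHist h k 0 = h k := by simp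

/-- THE IDENTITY BEHIND THE MODULE: dropping the finest coupling of the level-`(k+1)` prefix of a reversed history
gives its level-`k` prefix, `Fin.tail (revHist h (k+1)) = revHist h k` — so `ScaleShiftRate` compares CONSECUTIVE
β-functions on the prefixes of ONE semi-infinite history. [folklore] -/
theorem tail_revHist (h : ℕ → ℝ) (k : ℕ) : Fin.tail (revHist h (k + 1)) = revHist h k := by
  funext i
  show h (k + 1 - (i.succ : ℕ)) = h (k - i)
  rw [Fin.val_succ, Nat.add_sub_add_right]

/-- Prefixes of a box-valued history lie in the tree's boxes. [folklore] -/
theorem revHist_mem_box {γ : ℝ} {h : ℕ → ℝ} (hh : SeqBox γ h) (k : ℕ) : revHist h k ∈ Box γ k :=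
  mem_box.mpr fun i => hh (k - i)

/-- Entries of two box-valued histories differ by at most `γ`. [folklore] -/
theorem abs_sub_le_of_seqBox {γ : ℝ} {h h' : ℕ → ℝ} (hh : SeqBox γ h) (hh' : SeqBox γ h') (j : ℕ) :
    |h j - h' j| ≤ γ := by
  obtain ⟨h0, hγ⟩ := hh j
  obtain ⟨h0', hγ'⟩ := hh' j
  rw [abs_le]; constructor <;> linarith

/-- `0 ≤ γ` as soon as some history is box-valued. [folklore] -/
theorem gamma_nonneg_of_seqBox {γ : ℝ} {h : ℕ → ℝ} (hh : SeqBox γ h) : 0 ≤ γ :=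
  (hh 0).1.le.trans (hh 0).2

/-- PADDING a finite prefix `v = (g_0, …, g_k)` to a reversed history by a value `p`:
`padHist p v = (g_k, g_{k−1}, …, g_0, p, p, …)`. [folklore] -/
def padHist (p : ℝ) {k : ℕ} (v : Fin (k + 1) → ℝ) : ℕ → ℝ :=
  fun j => if hj : j ≤ k then v ⟨k - j, by omega⟩ else p

/-- Ages `j ≤ k` of the padded history read the prefix. [folklore] -/
theorem padHist_of_le (p : ℝ) {k : ℕ} (v : Fin (k + 1) → ℝ) {j : ℕ} (hj : j ≤ k) :
    padHist p v j = v ⟨k - j, by omega⟩ := by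
  simp [padHist, hj]

/-- Ages `j > k` of the padded history read the padding value. [folklore] -/
theorem padHist_of_lt (p : ℝ) {k : ℕ} (v : Fin (k + 1) → ℝ) {j : ℕ} (hj : k < j) : padHist p v j = p := by
  simp [padHist, not_le.mpr hj]

/-- The level-`k` prefix of the padded history is the prefix itself. [folklore] -/
theorem revHist_padHist (p : ℝ) {k : ℕ} (v : Fin (k + 1) → ℝ) : revHist (padHist p v) k = v := by
  funext i
  have hik : (i : ℕ) ≤ k := Nat.lt_succ_iff.mp i.2
  rw [revHist_apply, padHist_of_le p v (Nat.sub_le k i)]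
  congr 1
  exact Fin.ext (Nat.sub_sub_self hik)

/-- A padded box prefix with a padding value in `]0,γ]` is a box-valued history. [folklore] -/
theorem padHist_seqBox {γ p : ℝ} (hp0 : 0 < p) (hpγ : p ≤ γ) {k : ℕ} {v : Fin (k + 1) → ℝ} (hv : v ∈ Box γ k) :
    SeqBox γ (padHist p v) := by
  intro j
  by_cases hj : j ≤ k
  · rw [padHist_of_le p v hj]; exact mem_box.mp hv _
  · rw [padHist_of_lt p v (not_le.mp hj)]; exact ⟨hp0, hpγ⟩

/-- Padding `w = (g_0, …, g_{k+1})` and padding `Fin.tail w = (g_1, …, g_{k+1})` agree at every age `j ≤ k`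
(they differ only at age `k+1`: `g_0` versus `p`). [folklore] -/
theorem padHist_tail_of_le (p : ℝ) {k : ℕ} (w : Fin (k + 2) → ℝ) {j : ℕ} (hj : j ≤ k) :
    padHist p (Fin.tail w) j = padHist p w j := by
  rw [padHist_of_le p (Fin.tail w) hj, padHist_of_le p w (hj.trans (Nat.le_succ k))]
  show w (Fin.succ ⟨k - j, _⟩) = w ⟨k + 1 - j, _⟩
  congr 1
  refine Fin.ext ?_
  simp only [Fin.val_succ]
  omega

/-- AGE REINDEXING: a sum over the tree's positions `i` of a function of the age `k − i` is the sum over ages.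
[folklore] -/
theorem sum_fin_eq_sum_range_age (F : ℕ → ℝ) (k : ℕ) :
    ∑ i : Fin (k + 1), F (k - i) = ∑ j ∈ range (k + 1), F j := by
  have h1 : ∑ i : Fin (k + 1), F (k - i) = ∑ j ∈ range (k + 1), F (k - j) :=
    Fin.sum_univ_eq_sum_range (fun j => F (k - j)) (k + 1)
  have h2 : ∑ j ∈ range (k + 1), F (k + 1 - 1 - j) = ∑ j ∈ range (k + 1), F j :=
    Finset.sum_range_reflect F (k + 1)
  rw [h1, ← h2]
  simp only [Nat.add_sub_cancel]

/-! ## §2 `ScaleShiftRate` ⟹ ONE limit functional, at geometric rate -/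

/-- Along the prefixes of ONE box-valued reversed history the consecutive β-values have geometric differences:
`|β (k+1) (revHist h (k+1)) − β k (revHist h k)| ≤ c θ^k` — `ScaleShiftRate` read through `tail_revHist`, in node
U6's shape `T4CauchySum.GeomRate`. [folklore] -/
theorem geomRate_of_scaleShiftRate {c θ γ : ℝ} {β : HBeta} (hss : ScaleShiftRate c θ γ β) {h : ℕ → ℝ}
    (hh : SeqBox γ h) :
    GeomRate c θ (fun k => β (k + 1) (revHist h (k + 1)) - β k (revHist h k)) := by
  intro k
  have := hss k (revHist h (k + 1)) (revHist_mem_box hh (k + 1))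
  rwa [tail_revHist] at this

/-- THE CONTINUUM β-FUNCTIONAL of the family `β` at the reversed history `h`: the limit of the β-values on its
prefixes (a `limUnder`; meaningful under `ScaleShiftRate` with `θ < 1` on box-valued histories, `tendsto_betaInf`).
[folklore] -/
def betaInf (β : HBeta) (h : ℕ → ℝ) : ℝ := limUnder atTop fun k => β k (revHist h k)

/-- Under `ScaleShiftRate c θ γ β` with `θ < 1`, the β-values on the prefixes of a box-valued reversed history
CONVERGE to `betaInf β h`. [folklore] -/
theorem tendsto_betaInf {c θ γ : ℝ} {β : HBeta} (hss : ScaleShiftRate c θ γ β) (hθ1 : θ < 1) {h : ℕ → ℝ}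
    (hh : SeqBox γ h) : Tendsto (fun k => β k (revHist h k)) atTop (𝓝 (betaInf β h)) := by
  obtain ⟨a, ha, -⟩ :=
    exists_limit_of_geomRate (u := fun k => β k (revHist h k)) hθ1 (geomRate_of_scaleShiftRate hss hh)
  rwa [betaInf, ha.limUnder_eq]

/-- THE GEOMETRIC TAIL: `|β k (revHist h k) − betaInf β h| ≤ c θ^k/(1−θ)`. [folklore] -/
theorem abs_beta_revHist_sub_betaInf_le {c θ γ : ℝ} {β : HBeta} (hss : ScaleShiftRate c θ γ β) (hθ1 : θ < 1)
    {h : ℕ → ℝ} (hh : SeqBox γ h) (k : ℕ) :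
    |β k (revHist h k) - betaInf β h| ≤ c * θ ^ k / (1 - θ) := by
  obtain ⟨a, ha, hb⟩ :=
    exists_limit_of_geomRate (u := fun k => β k (revHist h k)) hθ1 (geomRate_of_scaleShiftRate hss hh)
  rw [betaInf, ha.limUnder_eq]
  exact hb k

/-- **REPRESENTATION**: on the box, `|β k v − betaInf β (padHist p v)| ≤ c θ^k/(1−θ)` for ANY padding value
`p ∈ ]0,γ]` — the k-th lattice β-function IS the one functional evaluated on (any box continuation of) its own
history, up to a geometric error uniform in the history. [folklore] -/
theorem abs_beta_sub_betaInf_padHist_le {c θ γ p : ℝ} {β : HBeta} (hss : ScaleShiftRate c θ γ β) (hθ1 : θ < 1)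
    (hp0 : 0 < p) (hpγ : p ≤ γ) {k : ℕ} {v : Fin (k + 1) → ℝ} (hv : v ∈ Box γ k) :
    |β k v - betaInf β (padHist p v)| ≤ c * θ ^ k / (1 - θ) := by
  have := abs_beta_revHist_sub_betaInf_le hss hθ1 (padHist_seqBox hp0 hpγ hv) k
  rwa [revHist_padHist] at this

/-- The constant of a `ScaleShiftRate` is non-negative as soon as the box is non-empty (`0 < γ`). [folklore] -/
theorem constant_nonneg_of_scaleShiftRate {c θ γ : ℝ} {β : HBeta} (hss : ScaleShiftRate c θ γ β) (hγ : 0 < γ) :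
    0 ≤ c := by
  have hw : (fun _ : Fin (0 + 2) => γ) ∈ Box γ (0 + 1) := mem_box.mpr fun _ => ⟨hγ, le_rfl⟩
  have := (abs_nonneg _).trans (hss 0 _ hw)
  simpa using this

/-! ## §3 `HistLipschitz ∧ FadingMemory` ⟹ geometric fading memory of the limit functional -/

/-- LEVEL-k MEMORY PROFILE: for box-valued reversed histories,
`|β k (revHist h k) − β k (revHist h′ k)| ≤ Σ_{j ≤ k} Cm θ^j |h j − h′ j|` (the history moduli bound the difference
position by position; fading memory weighs position `i` by `θ^(k−i)` = θ^age; reindex by age). [folklore] -/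
theorem abs_beta_revHist_sub_le_sum {Λ : ℕ → ℕ → ℝ} {Cm θ γ : ℝ} {β : HBeta} (hL : HistLipschitz Λ γ β)
    (hF : FadingMemory Cm θ Λ) {h h' : ℕ → ℝ} (hh : SeqBox γ h) (hh' : SeqBox γ h') (k : ℕ) :
    |β k (revHist h k) - β k (revHist h' k)| ≤ ∑ j ∈ range (k + 1), Cm * θ ^ j * |h j - h' j| := by
  have h1 := hL k (revHist h k) (revHist h' k) (revHist_mem_box hh k) (revHist_mem_box hh' k)
  have h2 : ∑ i : Fin (k + 1), Λ k i * |revHist h k i - revHist h' k i|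
      ≤ ∑ i : Fin (k + 1), Cm * θ ^ (k - (i : ℕ)) * |h (k - i) - h' (k - i)| := by
    refine Finset.sum_le_sum fun i _ => ?_
    rw [revHist_apply, revHist_apply]
    exact mul_le_mul_of_nonneg_right (hF k i (Nat.lt_succ_iff.mp i.2)).2 (abs_nonneg _)
  calc |β k (revHist h k) - β k (revHist h' k)|
      ≤ ∑ i : Fin (k + 1), Λ k i * |revHist h k i - revHist h' k i| := h1
    _ ≤ ∑ i : Fin (k + 1), Cm * θ ^ (k - (i : ℕ)) * |h (k - i) - h' (k - i)| := h2
    _ = ∑ j ∈ range (k + 1), Cm * θ ^ j * |h j - h' j| :=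
        sum_fin_eq_sum_range_age (fun j => Cm * θ ^ j * |h j - h' j|) k

/-- The memory constant of a `FadingMemory` profile is non-negative (`0 ≤ Λ 0 0 ≤ Cm·θ^0`). [folklore] -/
theorem constant_nonneg_of_fadingMemory {Cm θ : ℝ} {Λ : ℕ → ℕ → ℝ} (hF : FadingMemory Cm θ Λ) : 0 ≤ Cm := by
  have h00 := hF 0 0 le_rfl
  have := h00.1.trans h00.2
  simpa using this

/-- The age profile `θ^j |h j − h′ j|` of two box-valued histories is summable (`≤ γ θ^j`). [folklore] -/
theorem summable_profile {θ γ : ℝ} (hθ0 : 0 ≤ θ) (hθ1 : θ < 1) {h h' : ℕ → ℝ} (hh : SeqBox γ h)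
    (hh' : SeqBox γ h') : Summable fun j => θ ^ j * |h j - h' j| := by
  refine Summable.of_nonneg_of_le (fun j => mul_nonneg (pow_nonneg hθ0 j) (abs_nonneg _))
    (fun j => mul_le_mul_of_nonneg_left (abs_sub_le_of_seqBox hh hh' j) (pow_nonneg hθ0 j)) ?_
  exact (summable_geometric_of_lt_one hθ0 hθ1).mul_right γ

/-- Partial age profiles are below the total one. [folklore] -/
theorem sum_profile_le_tsum {θ γ : ℝ} (hθ0 : 0 ≤ θ) (hθ1 : θ < 1) {h h' : ℕ → ℝ} (hh : SeqBox γ h)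
    (hh' : SeqBox γ h') (n : ℕ) :
    ∑ j ∈ range n, θ ^ j * |h j - h' j| ≤ ∑' j, θ ^ j * |h j - h' j| :=
  (summable_profile hθ0 hθ1 hh hh').sum_le_tsum (range n) fun j _ => mul_nonneg (pow_nonneg hθ0 j) (abs_nonneg _)

/-- The total age profile is at most `γ/(1−θ)`. [folklore] -/
theorem tsum_profile_le {θ γ : ℝ} (hθ0 : 0 ≤ θ) (hθ1 : θ < 1) {h h' : ℕ → ℝ} (hh : SeqBox γ h)
    (hh' : SeqBox γ h') : ∑' j, θ ^ j * |h j - h' j| ≤ γ / (1 - θ) := by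
  have hs := summable_profile hθ0 hθ1 hh hh'
  have hg : Summable fun j : ℕ => θ ^ j * γ := (summable_geometric_of_lt_one hθ0 hθ1).mul_right γ
  calc ∑' j, θ ^ j * |h j - h' j| ≤ ∑' j : ℕ, θ ^ j * γ :=
        hs.tsum_le_tsum (fun j => mul_le_mul_of_nonneg_left (abs_sub_le_of_seqBox hh hh' j) (pow_nonneg hθ0 j)) hg
    _ = (∑' j : ℕ, θ ^ j) * γ := tsum_mul_right
    _ = γ / (1 - θ) := by rw [tsum_geometric_of_lt_one hθ0 hθ1]; ring

/-- If two box-valued histories AGREE at all ages `j < N`, every partial age profile is `≤ γ θ^N/(1−θ)`. [folklore] -/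
theorem sum_profile_le_of_agree {θ γ : ℝ} (hθ0 : 0 ≤ θ) (hθ1 : θ < 1) {h h' : ℕ → ℝ} (hh : SeqBox γ h)
    (hh' : SeqBox γ h') {N : ℕ} (hagree : ∀ j, j < N → h j = h' j) (n : ℕ) :
    ∑ j ∈ range n, θ ^ j * |h j - h' j| ≤ γ * θ ^ N / (1 - θ) := by
  have hγ : 0 ≤ γ := gamma_nonneg_of_seqBox hh
  have hfilter : (range n).filter (fun j => N ≤ j) = Ico N n := by
    ext j
    simp only [mem_filter, mem_range, mem_Ico]
    constructor
    · rintro ⟨h1, h2⟩; exact ⟨h2, h1⟩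
    · rintro ⟨h1, h2⟩; exact ⟨h2, h1⟩
  calc ∑ j ∈ range n, θ ^ j * |h j - h' j|
      = ∑ j ∈ range n, (if N ≤ j then θ ^ j * |h j - h' j| else 0) := by
        refine Finset.sum_congr rfl fun j _ => ?_
        split_ifs with hj
        · rfl
        · rw [hagree j (not_le.mp hj), sub_self, abs_zero, mul_zero]
    _ = ∑ j ∈ (range n).filter (fun j => N ≤ j), θ ^ j * |h j - h' j| := (Finset.sum_filter _ _).symm
    _ ≤ ∑ j ∈ (range n).filter (fun j => N ≤ j), θ ^ j * γ :=
        Finset.sum_le_sum fun j _ => mul_le_mul_of_nonneg_left (abs_sub_le_of_seqBox hh hh' j) (pow_nonneg hθ0 j)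
    _ = (∑ j ∈ Ico N n, θ ^ j) * γ := by rw [Finset.sum_mul, hfilter]
    _ ≤ θ ^ N / (1 - θ) * γ := mul_le_mul_of_nonneg_right (geom_sum_Ico_le_of_lt_one hθ0 hθ1) hγ
    _ = γ * θ ^ N / (1 - θ) := by ring

/-- HYPOTHESIS SHAPE (and, by `memoryProfile_betaInf`, a THEOREM about `betaInf β`) — GEOMETRIC MEMORY PROFILE of
a functional `B` on box-valued reversed histories: `|B h − B h′| ≤ Cm · Σ'_j θ^j |h j − h′ j|` — the influence of the
coupling of age `j` on `B` decays like `θ^j`. [folklore] -/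
def MemoryProfile (Cm θ γ : ℝ) (B : (ℕ → ℝ) → ℝ) : Prop :=
  ∀ h h' : ℕ → ℝ, SeqBox γ h → SeqBox γ h' → |B h - B h'| ≤ Cm * ∑' j, θ ^ j * |h j - h' j|

/-- **THE LIMIT FUNCTIONAL HAS GEOMETRIC FADING MEMORY**: `ScaleShiftRate c θ γ β` (for the limit to exist),
`HistLipschitz Λ γ β`, `FadingMemory Cm θ Λ`, `0 ≤ θ < 1` ⟹ `MemoryProfile Cm θ γ (betaInf β)`. [folklore] -/
theorem memoryProfile_betaInf {c Cm θ γ : ℝ} {Λ : ℕ → ℕ → ℝ} {β : HBeta} (hss : ScaleShiftRate c θ γ β)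
    (hL : HistLipschitz Λ γ β) (hF : FadingMemory Cm θ Λ) (hθ0 : 0 ≤ θ) (hθ1 : θ < 1) :
    MemoryProfile Cm θ γ (betaInf β) := by
  intro h h' hh hh'
  have hCm : 0 ≤ Cm := constant_nonneg_of_fadingMemory hF
  have ht := ((tendsto_betaInf hss hθ1 hh).sub (tendsto_betaInf hss hθ1 hh')).abs
  refine le_of_tendsto' ht fun k => ?_
  calc |β k (revHist h k) - β k (revHist h' k)|
      ≤ ∑ j ∈ range (k + 1), Cm * θ ^ j * |h j - h' j| := abs_beta_revHist_sub_le_sum hL hF hh hh' k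
    _ = Cm * ∑ j ∈ range (k + 1), θ ^ j * |h j - h' j| := by
        rw [Finset.mul_sum]
        exact Finset.sum_congr rfl fun j _ => by ring
    _ ≤ Cm * ∑' j, θ ^ j * |h j - h' j| :=
        mul_le_mul_of_nonneg_left (sum_profile_le_tsum hθ0 hθ1 hh hh' (k + 1)) hCm

/-- UNIFORM CONSEQUENCE: any two values of the limit functional differ by at most `Cm·γ/(1−θ)`. [folklore] -/
theorem abs_betaInf_sub_le {c Cm θ γ : ℝ} {Λ : ℕ → ℕ → ℝ} {β : HBeta} (hss : ScaleShiftRate c θ γ β)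
    (hL : HistLipschitz Λ γ β) (hF : FadingMemory Cm θ Λ) (hθ0 : 0 ≤ θ) (hθ1 : θ < 1) {h h' : ℕ → ℝ}
    (hh : SeqBox γ h) (hh' : SeqBox γ h') : |betaInf β h - betaInf β h'| ≤ Cm * (γ / (1 - θ)) :=
  (memoryProfile_betaInf hss hL hF hθ0 hθ1 h h' hh hh').trans
    (mul_le_mul_of_nonneg_left (tsum_profile_le hθ0 hθ1 hh hh') (constant_nonneg_of_fadingMemory hF))

/-- **DEPTH FORM OF THE MEMORY**: two box-valued histories that AGREE at all ages `j < N` have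
`|betaInf β h − betaInf β h′| ≤ Cm · γθ^N/(1−θ)` — what happened more than `N` scales towards the ultraviolet moves
the continuum β-value by at most a geometric amount. [folklore] -/
theorem abs_betaInf_sub_le_of_agree {c Cm θ γ : ℝ} {Λ : ℕ → ℕ → ℝ} {β : HBeta} (hss : ScaleShiftRate c θ γ β)
    (hL : HistLipschitz Λ γ β) (hF : FadingMemory Cm θ Λ) (hθ0 : 0 ≤ θ) (hθ1 : θ < 1) {h h' : ℕ → ℝ}
    (hh : SeqBox γ h) (hh' : SeqBox γ h') {N : ℕ} (hagree : ∀ j, j < N → h j = h' j) :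
    |betaInf β h - betaInf β h'| ≤ Cm * (γ * θ ^ N / (1 - θ)) := by
  have hCm : 0 ≤ Cm := constant_nonneg_of_fadingMemory hF
  have ht := ((tendsto_betaInf hss hθ1 hh).sub (tendsto_betaInf hss hθ1 hh')).abs
  refine le_of_tendsto' ht fun k => ?_
  calc |β k (revHist h k) - β k (revHist h' k)|
      ≤ ∑ j ∈ range (k + 1), Cm * θ ^ j * |h j - h' j| := abs_beta_revHist_sub_le_sum hL hF hh hh' k
    _ = Cm * ∑ j ∈ range (k + 1), θ ^ j * |h j - h' j| := by
        rw [Finset.mul_sum]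
        exact Finset.sum_congr rfl fun j _ => by ring
    _ ≤ Cm * (γ * θ ^ N / (1 - θ)) :=
        mul_le_mul_of_nonneg_left (sum_profile_le_of_agree hθ0 hθ1 hh hh' hagree (k + 1)) hCm

/-- THE PADDING VALUE IS IMMATERIAL up to `Cm·γθ^(k+1)/(1−θ)`: two box continuations of the same level-`k` prefix
give continuum β-values that close. [folklore] -/
theorem abs_betaInf_padHist_sub_padHist_le {c Cm θ γ p p' : ℝ} {Λ : ℕ → ℕ → ℝ} {β : HBeta}
    (hss : ScaleShiftRate c θ γ β) (hL : HistLipschitz Λ γ β) (hF : FadingMemory Cm θ Λ) (hθ0 : 0 ≤ θ)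
    (hθ1 : θ < 1) (hp0 : 0 < p) (hpγ : p ≤ γ) (hp0' : 0 < p') (hpγ' : p' ≤ γ) {k : ℕ} {v : Fin (k + 1) → ℝ}
    (hv : v ∈ Box γ k) :
    |betaInf β (padHist p v) - betaInf β (padHist p' v)| ≤ Cm * (γ * θ ^ (k + 1) / (1 - θ)) :=
  abs_betaInf_sub_le_of_agree hss hL hF hθ0 hθ1 (padHist_seqBox hp0 hpγ hv) (padHist_seqBox hp0' hpγ' hv)
    fun j hj => by rw [padHist_of_le p v (Nat.lt_succ_iff.mp hj), padHist_of_le p' v (Nat.lt_succ_iff.mp hj)]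

/-- A uniform LOWER bound passes to the limit functional: `BetaLowerH b γ β` ⇒ `b ≤ betaInf β h`. [folklore] -/
theorem le_betaInf_of_betaLower {c θ γ b : ℝ} {β : HBeta} (hss : ScaleShiftRate c θ γ β) (hθ1 : θ < 1)
    (hb : BetaLowerH b γ β) {h : ℕ → ℝ} (hh : SeqBox γ h) : b ≤ betaInf β h :=
  ge_of_tendsto' (tendsto_betaInf hss hθ1 hh) fun k => hb k _ (revHist_mem_box hh k)

/-- A uniform UPPER bound passes to the limit functional: `BetaUpperH β′ γ β` ⇒ `betaInf β h ≤ β′`. [folklore] -/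
theorem betaInf_le_of_betaUpper {c θ γ β' : ℝ} {β : HBeta} (hss : ScaleShiftRate c θ γ β) (hθ1 : θ < 1)
    (hB : BetaUpperH β' γ β) {h : ℕ → ℝ} (hh : SeqBox γ h) : betaInf β h ≤ β' :=
  le_of_tendsto' (tendsto_betaInf hss hθ1 hh) fun k => hB k _ (revHist_mem_box hh k)

/-- The β sub-cell's EVENTUAL lower bound (binder currency of `injectedRate_of_runs_eventual`) passes to the limit
functional: `EventualLowerH b γ k₀ β` ⇒ `b ≤ betaInf β h`. [folklore] -/
theorem le_betaInf_of_eventualLower {c θ γ b : ℝ} {k₀ : ℕ} {β : HBeta} (hss : ScaleShiftRate c θ γ β)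
    (hθ1 : θ < 1) (hb : EventualLowerH b γ k₀ β) {h : ℕ → ℝ} (hh : SeqBox γ h) : b ≤ betaInf β h :=
  ge_of_tendsto (tendsto_betaInf hss hθ1 hh)
    (eventually_atTop.2 ⟨k₀, fun k hk => hb k _ hk (revHist_mem_box hh k)⟩)

/-! ## §4 The converse: stationary families generated by a functional have the NE4 shapes -/

/-- THE STATIONARY FAMILY GENERATED BY A FUNCTIONAL `B` (and a padding value `p`): `β_k(v) = B (padHist p v)` — the
same functional at every scale, evaluated on the history continued by `p` beyond the bare end. [folklore] -/
def ofFunctional (B : (ℕ → ℝ) → ℝ) (p : ℝ) : HBeta := fun _ v => B (padHist p v)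

/-- Unfolding of `ofFunctional`. [folklore] -/
@[simp] theorem ofFunctional_apply (B : (ℕ → ℝ) → ℝ) (p : ℝ) (k : ℕ) (v : Fin (k + 1) → ℝ) :
    ofFunctional B p k v = B (padHist p v) := rfl

/-- The geometric profile `Λ k i = Cm θ^(k−i)` is a `FadingMemory Cm θ` profile. [folklore] -/
theorem fadingMemory_geom {Cm θ : ℝ} (hCm : 0 ≤ Cm) (hθ0 : 0 ≤ θ) :
    FadingMemory Cm θ (fun k i => Cm * θ ^ (k - i)) :=
  fun _ _ _ => ⟨mul_nonneg hCm (pow_nonneg hθ0 _), le_rfl⟩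

/-- For two paddings of level-`k` prefixes the age profile is a FINITE sum, and it is the tree-oriented sum with the
geometric moduli: `Σ'_j θ^j |padHist p v j − padHist p v′ j| = Σ_i θ^(k−i) |v i − v′ i|`. [folklore] -/
theorem tsum_profile_padHist (θ p : ℝ) {k : ℕ} (v v' : Fin (k + 1) → ℝ) :
    ∑' j, θ ^ j * |padHist p v j - padHist p v' j| = ∑ i : Fin (k + 1), θ ^ (k - (i : ℕ)) * |v i - v' i| := by
  have hvan : ∀ j, j ∉ range (k + 1) → θ ^ j * |padHist p v j - padHist p v' j| = 0 := by
    intro j hj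
    have hj' : k < j := by rw [Finset.mem_range] at hj; omega
    rw [padHist_of_lt p v hj', padHist_of_lt p v' hj', sub_self, abs_zero, mul_zero]
  rw [tsum_eq_sum hvan, ← sum_fin_eq_sum_range_age (fun j => θ ^ j * |padHist p v j - padHist p v' j|) k]
  refine Finset.sum_congr rfl fun i _ => ?_
  have e1 : padHist p v (k - i) = v i := congrFun (revHist_padHist p v) i
  have e2 : padHist p v' (k - i) = v' i := congrFun (revHist_padHist p v') i
  show θ ^ (k - (i : ℕ)) * |padHist p v (k - i) - padHist p v' (k - i)| = θ ^ (k - (i : ℕ)) * |v i - v' i|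
  rw [e1, e2]

/-- **A STATIONARY FAMILY HAS NODE U2's HISTORY MODULI WITH GEOMETRIC FADING MEMORY**: `MemoryProfile Cm θ γ B` ⇒
`HistLipschitz (fun k i => Cm θ^(k−i)) γ (ofFunctional B p)` (with `fadingMemory_geom`). [folklore] -/
theorem histLipschitz_ofFunctional {Cm θ γ p : ℝ} {B : (ℕ → ℝ) → ℝ} (hB : MemoryProfile Cm θ γ B) (hp0 : 0 < p)
    (hpγ : p ≤ γ) : HistLipschitz (fun k i => Cm * θ ^ (k - i)) γ (ofFunctional B p) := by
  intro k v v' hv hv'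
  have h1 := hB _ _ (padHist_seqBox hp0 hpγ hv) (padHist_seqBox hp0 hpγ hv')
  rw [tsum_profile_padHist] at h1
  calc |ofFunctional B p k v - ofFunctional B p k v'|
      = |B (padHist p v) - B (padHist p v')| := rfl
    _ ≤ Cm * ∑ i : Fin (k + 1), θ ^ (k - (i : ℕ)) * |v i - v' i| := h1
    _ = ∑ i : Fin (k + 1), Cm * θ ^ (k - (i : ℕ)) * |v i - v' i| := by
        rw [Finset.mul_sum]
        exact Finset.sum_congr rfl fun i _ => by ring

/-- **A STATIONARY FAMILY HAS NODE U2's SCALE-SHIFT RATE**: `MemoryProfile Cm θ γ B`, `0 ≤ Cm`, `0 ≤ θ` ⇒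
`ScaleShiftRate (Cm·γ·θ) θ γ (ofFunctional B p)` — padding `w` and padding `Fin.tail w` differ only at age `k+1`
(`g_0` versus `p`, by at most `γ`), which the profile weighs by `θ^(k+1)`. [folklore] -/
theorem scaleShiftRate_ofFunctional {Cm θ γ p : ℝ} {B : (ℕ → ℝ) → ℝ} (hB : MemoryProfile Cm θ γ B)
    (hCm : 0 ≤ Cm) (hp0 : 0 < p) (hpγ : p ≤ γ) (hθ0 : 0 ≤ θ) :
    ScaleShiftRate (Cm * γ * θ) θ γ (ofFunctional B p) := by
  intro k w hw
  have htw : Fin.tail w ∈ Box γ k := mem_box.mpr fun i => mem_box.mp hw i.succ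
  have h1 := hB _ _ (padHist_seqBox hp0 hpγ hw) (padHist_seqBox hp0 hpγ htw)
  have hvan : ∀ j, j ∉ ({k + 1} : Finset ℕ) → θ ^ j * |padHist p w j - padHist p (Fin.tail w) j| = 0 := by
    intro j hj
    have hj' : j ≠ k + 1 := by simpa using hj
    rcases lt_or_gt_of_ne hj' with hlt | hgt
    · rw [← padHist_tail_of_le p w (Nat.lt_succ_iff.mp hlt), sub_self, abs_zero, mul_zero]
    · rw [padHist_of_lt p w hgt, padHist_of_lt p (Fin.tail w) (by omega), sub_self, abs_zero, mul_zero]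
  have h2 : ∑' j, θ ^ j * |padHist p w j - padHist p (Fin.tail w) j|
      = θ ^ (k + 1) * |padHist p w (k + 1) - padHist p (Fin.tail w) (k + 1)| := by
    rw [tsum_eq_sum hvan, Finset.sum_singleton]
  have h3 : |padHist p w (k + 1) - padHist p (Fin.tail w) (k + 1)| ≤ γ := by
    rw [padHist_of_le p w le_rfl, padHist_of_lt p (Fin.tail w) (Nat.lt_succ_self k)]
    obtain ⟨hw0, hwγ⟩ := mem_box.mp hw ⟨k + 1 - (k + 1), by omega⟩
    rw [abs_le]; constructor <;> linarith
  calc |ofFunctional B p (k + 1) w - ofFunctional B p k (Fin.tail w)|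
      = |B (padHist p w) - B (padHist p (Fin.tail w))| := rfl
    _ ≤ Cm * ∑' j, θ ^ j * |padHist p w j - padHist p (Fin.tail w) j| := h1
    _ = Cm * (θ ^ (k + 1) * |padHist p w (k + 1) - padHist p (Fin.tail w) (k + 1)|) := by rw [h2]
    _ ≤ Cm * (θ ^ (k + 1) * γ) :=
        mul_le_mul_of_nonneg_left (mul_le_mul_of_nonneg_left h3 (pow_nonneg hθ0 _)) hCm
    _ = Cm * γ * θ * θ ^ k := by ring

/-- **FAMILIES NEAR A FUNCTIONAL HAVE THE SCALE-SHIFT RATE**: if `|β k v − B (padHist p v)| ≤ c′ θ^k` on the boxes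
and `B` has `MemoryProfile Cm θ γ`, then `ScaleShiftRate (Cm·γ·θ + 2c′) θ γ β` (`0 ≤ θ ≤ 1`). [folklore] -/
theorem scaleShiftRate_of_near_ofFunctional {Cm θ γ p c' : ℝ} {B : (ℕ → ℝ) → ℝ} {β : HBeta}
    (hB : MemoryProfile Cm θ γ B) (hCm : 0 ≤ Cm) (hp0 : 0 < p) (hpγ : p ≤ γ) (hθ0 : 0 ≤ θ) (hθ1 : θ ≤ 1)
    (hnear : ∀ k (v : Fin (k + 1) → ℝ), v ∈ Box γ k → |β k v - B (padHist p v)| ≤ c' * θ ^ k) :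
    ScaleShiftRate (Cm * γ * θ + 2 * c') θ γ β := by
  intro k w hw
  have htw : Fin.tail w ∈ Box γ k := mem_box.mpr fun i => mem_box.mp hw i.succ
  have h0 := scaleShiftRate_ofFunctional hB hCm hp0 hpγ hθ0 k w hw
  simp only [ofFunctional_apply] at h0
  have h1 := hnear (k + 1) w hw
  have h2 := hnear k (Fin.tail w) htw
  have hc' : 0 ≤ c' := by
    have := (abs_nonneg _).trans (hnear 0 (fun _ => p) (mem_box.mpr fun _ => ⟨hp0, hpγ⟩))
    simpa using this
  have hθk : θ ^ (k + 1) ≤ θ ^ k := pow_le_pow_of_le_one hθ0 hθ1 (Nat.le_succ k)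
  calc |β (k + 1) w - β k (Fin.tail w)|
      = |(β (k + 1) w - B (padHist p w)) + (B (padHist p w) - B (padHist p (Fin.tail w)))
          - (β k (Fin.tail w) - B (padHist p (Fin.tail w)))| := by congr 1; ring
    _ ≤ |β (k + 1) w - B (padHist p w)| + |B (padHist p w) - B (padHist p (Fin.tail w))|
          + |β k (Fin.tail w) - B (padHist p (Fin.tail w))| :=
        (abs_sub _ _).trans (add_le_add (abs_add_le _ _) le_rfl)
    _ ≤ c' * θ ^ (k + 1) + Cm * γ * θ * θ ^ k + c' * θ ^ k := add_le_add (add_le_add h1 h0) h2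
    _ ≤ (Cm * γ * θ + 2 * c') * θ ^ k := by nlinarith [mul_le_mul_of_nonneg_left hθk hc']

/-- **ROUND TRIP (the hypothesis CLASS is stable)**: node U2's NE4 shapes with constants `(c, Cm, θ)` give, through
the limit functional `betaInf β` (its memory profile `memoryProfile_betaInf` and the representation
`abs_beta_sub_betaInf_padHist_le`), node U2's scale-shift rate back with constant `Cm·γ·θ + 2c/(1−θ)` — nothing but
constants is lost in passing to the stationary description. [folklore] -/
theorem scaleShiftRate_roundTrip {c Cm θ γ p : ℝ} {Λ : ℕ → ℕ → ℝ} {β : HBeta} (hss : ScaleShiftRate c θ γ β)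
    (hL : HistLipschitz Λ γ β) (hF : FadingMemory Cm θ Λ) (hθ0 : 0 ≤ θ) (hθ1 : θ < 1) (hp0 : 0 < p)
    (hpγ : p ≤ γ) : ScaleShiftRate (Cm * γ * θ + 2 * (c / (1 - θ))) θ γ β :=
  scaleShiftRate_of_near_ofFunctional (memoryProfile_betaInf hss hL hF hθ0 hθ1)
    (constant_nonneg_of_fadingMemory hF) hp0 hpγ hθ0 hθ1.le
    fun k v hv => (abs_beta_sub_betaInf_padHist_le hss hθ1 hp0 hpγ hv).trans_eq (by ring)

/-! ## §5 Identification with P2's continuum couplings: the autonomous limit flow -/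

section Continuum

variable {β : HBeta} {g : ℕ → ℕ → ℝ} {C θ γ c Cm θs : ℝ} {Λ : ℕ → ℕ → ℝ}

/-- THE REVERSED HISTORY OF A RUN ABOVE A PHYSICAL SCALE: for the run with `n + m + 1` steps, the couplings at
indices `n, n−1, …, 0` (i.e. `m+1, m+2, …` scales above its infrared end), continued by its bare coupling:
`histAbove g m n j = g (n+m+1) (n − j)` (ℕ-subtraction: ages `j > n` read `g (n+m+1) 0`, still in the box).
[folklore] -/
def histAbove (g : ℕ → ℕ → ℝ) (m n : ℕ) : ℕ → ℝ := fun j => g (n + m + 1) (n - j)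

/-- Its level-`n` prefix is the run's own prefix, the argument of P2's diagonal β-value:
`revHist (histAbove g m n) n = prefixOf (g (n+m+1)) n`. [folklore] -/
theorem revHist_histAbove (g : ℕ → ℕ → ℝ) (m n : ℕ) :
    revHist (histAbove g m n) n = prefixOf (g (n + m + 1)) n := by
  funext i
  simp [histAbove, prefixOf, Nat.sub_sub_self (Nat.lt_succ_iff.mp i.2)]

/-- Runs in the box give box-valued histories. [folklore] -/
theorem histAbove_seqBox (hbox : ∀ K i, i ≤ K → 0 < g K i ∧ g K i ≤ γ) (m n : ℕ) :
    SeqBox γ (histAbove g m n) :=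
  fun j => hbox (n + m + 1) (n - j) (by omega)

/-- THE LIMIT HISTORY above physical scale `m`: `limHist g m j = gstar g (m + 1 + j)` — P2's continuum couplings at
the physical scales `m+1, m+2, …` (towards the ultraviolet). [folklore] -/
def limHist (g : ℕ → ℕ → ℝ) (m : ℕ) : ℕ → ℝ := fun j => gstar g (m + 1 + j)

/-- Unfolding of `limHist`. [folklore] -/
@[simp] theorem limHist_apply (g : ℕ → ℕ → ℝ) (m j : ℕ) : limHist g m j = gstar g (m + 1 + j) := rfl

/-- The limit history is box-valued (`gstar_pos`, `gstar_le`). [folklore] -/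
theorem limHist_seqBox (hθ1 : θ < 1) (hinj : InjectedRate C 0 θ (fun K j => disc (g K) (g (K + 1)) j))
    (hbox : ∀ K i, i ≤ K → 0 < g K i ∧ g K i ≤ γ) (m : ℕ) : SeqBox γ (limHist g m) :=
  fun _ => ⟨gstar_pos hθ1 hinj hbox _, gstar_le hθ1 hinj hbox _⟩

/-- AGEWISE CONVERGENCE OF THE HISTORIES: for each age `j`, `histAbove g m n j → gstar g (m+1+j)` as `n → ∞`
(P2's `tendsto_coupling` at physical scale `m+1+j`, composed with `n ↦ n − j`). [folklore] -/
theorem tendsto_histAbove (hθ1 : θ < 1) (hinj : InjectedRate C 0 θ (fun K j => disc (g K) (g (K + 1)) j))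
    (hbox : ∀ K i, i ≤ K → 0 < g K i ∧ g K i ≤ γ) (m j : ℕ) :
    Tendsto (fun n => histAbove g m n j) atTop (𝓝 (limHist g m j)) := by
  have h1 := (tendsto_coupling hθ1 hinj hbox (m + 1 + j)).comp (tendsto_sub_atTop_nat j)
  refine h1.congr' ?_
  filter_upwards [eventually_ge_atTop j] with n hn
  show g (n - j + (m + 1 + j)) (n - j) = g (n + m + 1) (n - j)
  congr 1
  omega

/-- TANNERY STEP: under node U2's shapes, the limit functional along the runs' histories converges to its value at
the limit history, `betaInf β (histAbove g m n) → betaInf β (limHist g m)` (memory profile + agewise convergence +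
domination by `γθs^j`, Mathlib `tendsto_tsum_of_dominated_convergence`). [folklore] -/
theorem tendsto_betaInf_histAbove (hθ1 : θ < 1)
    (hinj : InjectedRate C 0 θ (fun K j => disc (g K) (g (K + 1)) j))
    (hbox : ∀ K i, i ≤ K → 0 < g K i ∧ g K i ≤ γ) (hss : ScaleShiftRate c θs γ β) (hL : HistLipschitz Λ γ β)
    (hF : FadingMemory Cm θs Λ) (hθs0 : 0 ≤ θs) (hθs1 : θs < 1) (m : ℕ) :
    Tendsto (fun n => betaInf β (histAbove g m n)) atTop (𝓝 (betaInf β (limHist g m))) := by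
  have hlim := limHist_seqBox hθ1 hinj hbox m
  have hprof := memoryProfile_betaInf hss hL hF hθs0 hθs1
  have hCm : 0 ≤ Cm := constant_nonneg_of_fadingMemory hF
  have hT : Tendsto (fun n => ∑' j, θs ^ j * |histAbove g m n j - limHist g m j|) atTop
      (𝓝 (∑' j, θs ^ j * |limHist g m j - limHist g m j|)) := by
    refine tendsto_tsum_of_dominated_convergence (bound := fun j => θs ^ j * γ)
      ((summable_geometric_of_lt_one hθs0 hθs1).mul_right γ) (fun j => ?_) (Eventually.of_forall fun n j => ?_)
    · exact (((tendsto_histAbove hθ1 hinj hbox m j).sub tendsto_const_nhds).abs).const_mul (θs ^ j)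
    · rw [Real.norm_eq_abs, abs_of_nonneg (mul_nonneg (pow_nonneg hθs0 j) (abs_nonneg _))]
      exact mul_le_mul_of_nonneg_left (abs_sub_le_of_seqBox (histAbove_seqBox hbox m n) hlim j)
        (pow_nonneg hθs0 j)
  have hT0 : Tendsto (fun n => Cm * ∑' j, θs ^ j * |histAbove g m n j - limHist g m j|) atTop (𝓝 0) := by
    simpa using hT.const_mul Cm
  refine tendsto_sub_nhds_zero_iff.1 (squeeze_zero_norm (fun n => ?_) hT0)
  rw [Real.norm_eq_abs]
  exact hprof _ _ (histAbove_seqBox hbox m n) hlim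

/-- **THE DIAGONAL β-VALUES CONVERGE TO THE LIMIT FUNCTIONAL AT THE LIMIT HISTORY**:
`β n (prefixOf (g (n+m+1)) n) → betaInf β (limHist g m)` (representation tail `cθs^n/(1−θs)` + Tannery step).
[folklore] -/
theorem tendsto_beta_diag_betaInf (hθ1 : θ < 1)
    (hinj : InjectedRate C 0 θ (fun K j => disc (g K) (g (K + 1)) j))
    (hbox : ∀ K i, i ≤ K → 0 < g K i ∧ g K i ≤ γ) (hss : ScaleShiftRate c θs γ β) (hL : HistLipschitz Λ γ β)
    (hF : FadingMemory Cm θs Λ) (hθs0 : 0 ≤ θs) (hθs1 : θs < 1) (m : ℕ) :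
    Tendsto (fun n => β n (prefixOf (g (n + m + 1)) n)) atTop (𝓝 (betaInf β (limHist g m))) := by
  have h1 : Tendsto (fun n => β n (revHist (histAbove g m n) n) - betaInf β (histAbove g m n)) atTop (𝓝 0) := by
    have hr : Tendsto (fun n => c * θs ^ n / (1 - θs)) atTop (𝓝 (c * 0 / (1 - θs))) :=
      ((tendsto_pow_atTop_nhds_zero_of_lt_one hθs0 hθs1).const_mul c).div_const (1 - θs)
    rw [mul_zero, zero_div] at hr
    refine squeeze_zero_norm (fun n => ?_) hr
    rw [Real.norm_eq_abs]
    exact abs_beta_revHist_sub_betaInf_le hss hθs1 (histAbove_seqBox hbox m n) n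
  have h2 := tendsto_betaInf_histAbove hθ1 hinj hbox hss hL hF hθs0 hθs1 m
  have h3 := h1.add h2
  rw [zero_add] at h3
  refine h3.congr fun n => ?_
  rw [sub_add_cancel, revHist_histAbove]

/-- **IDENTIFICATION**: P2's continuum β-value at physical scale `m` IS the limit functional evaluated on the
limit trajectory's history above that scale: `bstar g m = betaInf β (limHist g m)` (uniqueness of limits, P2's
`tendsto_beta_diag` and `tendsto_beta_diag_betaInf`). [folklore] -/
theorem bstar_eq_betaInf (hθ1 : θ < 1) (hinj : InjectedRate C 0 θ (fun K j => disc (g K) (g (K + 1)) j))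
    (hbox : ∀ K i, i ≤ K → 0 < g K i ∧ g K i ≤ γ) (hrun : ∀ K, RGEqH K β (g K))
    (hss : ScaleShiftRate c θs γ β) (hL : HistLipschitz Λ γ β) (hF : FadingMemory Cm θs Λ) (hθs0 : 0 ≤ θs)
    (hθs1 : θs < 1) (m : ℕ) : bstar g m = betaInf β (limHist g m) :=
  tendsto_nhds_unique (tendsto_beta_diag hθ1 hinj hrun m)
    (tendsto_beta_diag_betaInf hθ1 hinj hbox hss hL hF hθs0 hθs1 m)

/-- **THE AUTONOMOUS LIMIT FLOW**: `1/(gstar g (m+1))² = 1/(gstar g m)² + betaInf β (fun j => gstar g (m+1+j))` —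
(0.20) in the continuum, scale by scale upward from `gstar g 0 = g_IR`, with ONE scale-independent β-FUNCTIONAL
evaluated on the limit trajectory's own ultraviolet history (P2's `gstar_flow` with `bstar_eq_betaInf`). [folklore] -/
theorem gstar_flow_autonomous (hθ1 : θ < 1) (hinj : InjectedRate C 0 θ (fun K j => disc (g K) (g (K + 1)) j))
    (hbox : ∀ K i, i ≤ K → 0 < g K i ∧ g K i ≤ γ) (hrun : ∀ K, RGEqH K β (g K))
    (hss : ScaleShiftRate c θs γ β) (hL : HistLipschitz Λ γ β) (hF : FadingMemory Cm θs Λ) (hθs0 : 0 ≤ θs)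
    (hθs1 : θs < 1) (m : ℕ) :
    1 / (gstar g (m + 1)) ^ 2 = 1 / (gstar g m) ^ 2 + betaInf β (fun j => gstar g (m + 1 + j)) := by
  rw [gstar_flow hθ1 hinj hbox m, bstar_eq_betaInf hθ1 hinj hbox hrun hss hL hF hθs0 hθs1 m]
  rfl

/-- THE MEMORY OF THE LIMIT FLOW: the continuum β-values at two physical scales whose limit histories agree to depth
`N` differ by at most `Cm·γθs^N/(1−θs)`; in general any two differ by at most `Cm·γ/(1−θs)` — uniform closeness of
the `bstar g m`, a K-uniform statement P2's diagonal description does not display. [folklore] -/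
theorem abs_bstar_sub_bstar_le (hθ1 : θ < 1) (hinj : InjectedRate C 0 θ (fun K j => disc (g K) (g (K + 1)) j))
    (hbox : ∀ K i, i ≤ K → 0 < g K i ∧ g K i ≤ γ) (hrun : ∀ K, RGEqH K β (g K))
    (hss : ScaleShiftRate c θs γ β) (hL : HistLipschitz Λ γ β) (hF : FadingMemory Cm θs Λ) (hθs0 : 0 ≤ θs)
    (hθs1 : θs < 1) (m m' : ℕ) : |bstar g m - bstar g m'| ≤ Cm * (γ / (1 - θs)) := by
  rw [bstar_eq_betaInf hθ1 hinj hbox hrun hss hL hF hθs0 hθs1 m,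
    bstar_eq_betaInf hθ1 hinj hbox hrun hss hL hF hθs0 hθs1 m']
  exact abs_betaInf_sub_le hss hL hF hθs0 hθs1 (limHist_seqBox hθ1 hinj hbox m) (limHist_seqBox hθ1 hinj hbox m')

end Continuum

/-! ## §6 Dependency lemma: node U2's Lipschitz input implies the headline's continuity binder (C) -/

/-- `HistLipschitz Λ γ β → BetaContH γ β`: a history-Lipschitz family is continuous on every box (sup metric on
`Fin (k+1) → ℝ`, `dist_le_pi_dist`; no sign condition on `Λ` is needed).  So on the same box the headline binder (C)
`hC : FlowStep.BetaContH γ β` of `T4ContinuumYM4Torus.continuumYM4_torus_of_BetaPertH` is implied by node U2's input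
`HistLipschitz`; the converse fails (GAPS G-t4-U2-2, `T4CouplingMatching.histLipschitz_of_coordLipschitz` docstring).
[folklore] -/
theorem betaContH_of_histLipschitz {Λ : ℕ → ℕ → ℝ} {γ : ℝ} {β : HBeta} (hL : HistLipschitz Λ γ β) :
    BetaContH γ β := by
  intro k
  rw [Metric.continuousOn_iff]
  intro q hq ε hε
  set S : ℝ := ∑ i : Fin (k + 1), |Λ k i| with hS
  have hS0 : 0 ≤ S := Finset.sum_nonneg fun i _ => abs_nonneg _
  refine ⟨ε / (S + 1), div_pos hε (by linarith), fun p hp hpq => ?_⟩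
  rw [Real.dist_eq]
  have h1 := hL k p q hp hq
  have h2 : ∑ i : Fin (k + 1), Λ k i * |p i - q i| ≤ ∑ i : Fin (k + 1), |Λ k i| * dist p q := by
    refine Finset.sum_le_sum fun i _ => ?_
    calc Λ k i * |p i - q i| ≤ |Λ k i| * |p i - q i| :=
          mul_le_mul_of_nonneg_right (le_abs_self _) (abs_nonneg _)
      _ ≤ |Λ k i| * dist p q :=
          mul_le_mul_of_nonneg_left (by rw [← Real.dist_eq]; exact dist_le_pi_dist p q i) (abs_nonneg _)
  have hlt : S / (S + 1) < 1 := (div_lt_one (by linarith)).mpr (by linarith)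
  calc |β k p - β k q| ≤ ∑ i : Fin (k + 1), |Λ k i| * dist p q := h1.trans h2
    _ = S * dist p q := by rw [hS, Finset.sum_mul]
    _ ≤ S * (ε / (S + 1)) := mul_le_mul_of_nonneg_left hpq.le hS0
    _ = ε * (S / (S + 1)) := by ring
    _ < ε * 1 := mul_lt_mul_of_pos_left hlt hε
    _ = ε := mul_one ε

/-! ## §7 Probes: non-vacuity with genuine memory, and the memoryless case -/

namespace Probes

/-- THE EXPONENTIALLY WEIGHTED HISTORY AVERAGE `expAvg a θ h = a · Σ'_j θ^j · h j` — a functional depending on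
EVERY past coupling, with geometric weights. [folklore] -/
def expAvg (a θ : ℝ) (h : ℕ → ℝ) : ℝ := a * ∑' j, θ ^ j * h j

/-- Box-valued histories have summable weighted entries. [folklore] -/
theorem summable_weighted {θ γ : ℝ} (hθ0 : 0 ≤ θ) (hθ1 : θ < 1) {h : ℕ → ℝ} (hh : SeqBox γ h) :
    Summable fun j => θ ^ j * h j := by
  refine Summable.of_nonneg_of_le (fun j => mul_nonneg (pow_nonneg hθ0 j) (hh j).1.le)
    (fun j => mul_le_mul_of_nonneg_left (hh j).2 (pow_nonneg hθ0 j)) ?_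
  exact (summable_geometric_of_lt_one hθ0 hθ1).mul_right γ

/-- `expAvg a θ` has the geometric memory profile `MemoryProfile |a| θ γ`. [folklore] -/
theorem memoryProfile_expAvg {a θ γ : ℝ} (hθ0 : 0 ≤ θ) (hθ1 : θ < 1) : MemoryProfile |a| θ γ (expAvg a θ) := by
  intro h h' hh hh'
  have hs := summable_weighted hθ0 hθ1 hh
  have hs' := summable_weighted hθ0 hθ1 hh'
  have hdiff : ∑' j, θ ^ j * h j - ∑' j, θ ^ j * h' j = ∑' j, θ ^ j * (h j - h' j) := by
    rw [← hs.tsum_sub hs']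
    exact tsum_congr fun j => by ring
  have hnorm : Summable fun j => ‖θ ^ j * (h j - h' j)‖ := by
    have := summable_profile hθ0 hθ1 hh hh'
    refine this.congr fun j => ?_
    rw [Real.norm_eq_abs, abs_mul, abs_of_nonneg (pow_nonneg hθ0 j)]
  have habs : |∑' j, θ ^ j * (h j - h' j)| ≤ ∑' j, θ ^ j * |h j - h' j| := by
    have := norm_tsum_le_tsum_norm hnorm
    rw [Real.norm_eq_abs] at this
    refine this.trans (le_of_eq (tsum_congr fun j => ?_))
    rw [Real.norm_eq_abs, abs_mul, abs_of_nonneg (pow_nonneg hθ0 j)]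
  calc |expAvg a θ h - expAvg a θ h'| = |a * (∑' j, θ ^ j * h j - ∑' j, θ ^ j * h' j)| := by
        unfold expAvg; rw [mul_sub]
    _ = |a| * |∑' j, θ ^ j * (h j - h' j)| := by rw [abs_mul, hdiff]
    _ ≤ |a| * ∑' j, θ ^ j * |h j - h' j| := mul_le_mul_of_nonneg_left habs (abs_nonneg a)

/-- NON-VACUITY OF NODE U2's NE4 TRIPLE WITH GENUINE MEMORY: the stationary family generated by `expAvg a θ` (each
`β_k` depends on ALL of `g_0, …, g_k`) satisfies `ScaleShiftRate (|a|γθ) θ γ`, `HistLipschitz (fun k i => |a|θ^(k−i)) γ`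
and `FadingMemory |a| θ (fun k i => |a|θ^(k−i))` — §4 BY NAME. [folklore] -/
example {a θ γ p : ℝ} (hθ0 : 0 ≤ θ) (hθ1 : θ < 1) (hp0 : 0 < p) (hpγ : p ≤ γ) :
    ScaleShiftRate (|a| * γ * θ) θ γ (ofFunctional (expAvg a θ) p)
      ∧ HistLipschitz (fun k i => |a| * θ ^ (k - i)) γ (ofFunctional (expAvg a θ) p)
      ∧ FadingMemory |a| θ (fun k i => |a| * θ ^ (k - i)) :=
  ⟨scaleShiftRate_ofFunctional (memoryProfile_expAvg hθ0 hθ1) (abs_nonneg a) hp0 hpγ hθ0,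
   histLipschitz_ofFunctional (memoryProfile_expAvg hθ0 hθ1) hp0 hpγ,
   fadingMemory_geom (abs_nonneg a) hθ0⟩

/-- … and therefore has a continuum β-functional with the same memory profile, to which its β-values converge at
rate `|a|γθ·θ^k/(1−θ)` — §2/§3 BY NAME. [folklore] -/
example {a θ γ p : ℝ} (hθ0 : 0 ≤ θ) (hθ1 : θ < 1) (hp0 : 0 < p) (hpγ : p ≤ γ) :
    MemoryProfile |a| θ γ (betaInf (ofFunctional (expAvg a θ) p)) :=
  memoryProfile_betaInf (scaleShiftRate_ofFunctional (memoryProfile_expAvg hθ0 hθ1) (abs_nonneg a) hp0 hpγ hθ0)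
    (histLipschitz_ofFunctional (memoryProfile_expAvg hθ0 hθ1) hp0 hpγ) (fadingMemory_geom (abs_nonneg a) hθ0)
    hθ0 hθ1

/-- THE MEMORYLESS CASE: a functional reading only the last coupling, `B h = f (h 0)`, generates the STATIONARY
Markov family `β_k(v) = f(v_k)` (`ofFunctional B p k v = f (v (Fin.last k))`, independently of the padding).
[folklore] -/
example (f : ℝ → ℝ) (p : ℝ) (k : ℕ) (v : Fin (k + 1) → ℝ) :
    ofFunctional (fun h => f (h 0)) p k v = f (v (Fin.last k)) := by
  rw [ofFunctional_apply, padHist_of_le p v (Nat.zero_le k)]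
  rfl

/-- … and a Lipschitz `f` (constant `L ≥ 0` on `]0,γ]`) gives it the memory profile `MemoryProfile L θ γ` for EVERY
rate `θ ∈ [0,1[` (only the age-0 term is used, `Summable.le_tsum`), whence the NE4 triple by §4. [folklore] -/
example {f : ℝ → ℝ} {L θ γ : ℝ} (hL : 0 ≤ L) (hθ0 : 0 ≤ θ) (hθ1 : θ < 1)
    (hf : ∀ x y, 0 < x → x ≤ γ → 0 < y → y ≤ γ → |f x - f y| ≤ L * |x - y|) :
    MemoryProfile L θ γ (fun h => f (h 0)) := by
  intro h h' hh hh'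
  have h0 := hf (h 0) (h' 0) (hh 0).1 (hh 0).2 (hh' 0).1 (hh' 0).2
  have h1 : θ ^ 0 * |h 0 - h' 0| ≤ ∑' j, θ ^ j * |h j - h' j| :=
    (summable_profile hθ0 hθ1 hh hh').le_tsum 0 fun j _ => mul_nonneg (pow_nonneg hθ0 j) (abs_nonneg _)
  rw [pow_zero, one_mul] at h1
  exact h0.trans (mul_le_mul_of_nonneg_left h1 hL)

end Probes

end

end Literature.MathematicalPhysics.QuantumFieldTheory.Balaban1983to89.T4BetaStationary
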